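import Literature.NumberTheory.EllipticCurves.ModularSymbolRepProofs

/-!
# `ManinStokes` (stmt-KontsevichZagierPeriods-5277): the reflection `z ↦ −z̄` on the tile integrand

Support file (prover-owned, `--supports stmt-KontsevichZagierPeriods-5277`). The mirror tiles `τ₀*` of
the barycentric subdivision are the images of `τ₀` under `σ : z ↦ −z̄`; this file transports the tile
integrand `ω/dj` across `σ`: the level-one Eisenstein series and `Δ` have real `q`-expansions, so
`E(−τ̄) = conj E(τ)` (`E_negConjPt`, Mathlib's `EisensteinSeries.E_qExpansion_coeff`), `Δ(−τ̄) = conj Δ(τ)`;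
`g^ε · (−τ̄) = −conj(g·τ)` for the reflected matrix `g^ε = reflect g` of `ModularSymbolRep` and every `τ`
(the tree has it on the axis), hence `(f ∣ h)(−τ̄) = conj (f ∣ h^ε)(τ)` and
`(ω/dj)(f ∣ h)(−τ̄) = conj ((ω/dj)(f ∣ h^ε)(τ))` for cusp forms `f` with real Fourier coefficients
(`djQuot_slash_negConjPt`); and `T⁻¹·(1/2 + it) = −conj(1/2 + it)`.

References: J. E. Cremona, *Algorithms for Modular Elliptic Curves* (1997), §2.1, §2.8. No definitions,
no named facts.
-/

noncomputable section

open scoped MatrixGroups ModularForm Modular Manifold Topology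
open CongruenceSubgroup Complex Set Filter MeasureTheory ModularForm
open UpperHalfPlane hiding I
open Literature.NumberTheory.EllipticCurves Literature.NumberTheory.EllipticCurves.ModularForms

namespace Summit.KontsevichZagierPeriods.HeckeMultiplicityOne.ManinStokes

variable {N : ℕ}

/-- **`E_k(−τ̄) = conj E_k(τ)`** for the level-one Eisenstein series (real `q`-expansion,
Mathlib's `EisensteinSeries.E_qExpansion_coeff`). [folklore] -/
theorem E_negConjPt {k : ℕ} (hk : 3 ≤ k) (hk2 : Even k) (τ : ℍ) :
    ModularForm.E hk (negConjPt τ) = (starRingEnd ℂ) (ModularForm.E hk τ) := by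
  refine apply_negConjPt_of_hasSum (φ := ⇑(ModularForm.E hk))
    (c := fun n => (qExpansion 1 (ModularForm.E hk)).coeff n) (fun τ => ?_) (fun n => ?_) τ
  · have h := hasSum_qExpansion one_pos
      (SlashInvariantFormClass.periodic_comp_ofComplex (ModularForm.E hk) one_mem_strictPeriods_SL)
      (ModularForm.E hk).holo' (ModularFormClass.bdd_at_infty (ModularForm.E hk)) τ
    simpa [smul_eq_mul] using h
  · simp only [EisensteinSeries.E_qExpansion_coeff hk hk2]
    split_ifs
    · simp
    · simp [map_ofNat]

/-- `E₄(−τ̄) = conj E₄(τ)`. [folklore] -/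
theorem E₄_negConjPt (τ : ℍ) : E₄ (negConjPt τ) = (starRingEnd ℂ) (E₄ τ) :=
  E_negConjPt (by norm_num) (by decide) τ

/-- `E₆(−τ̄) = conj E₆(τ)`. [folklore] -/
theorem E₆_negConjPt (τ : ℍ) : E₆ (negConjPt τ) = (starRingEnd ℂ) (E₆ τ) :=
  E_negConjPt (by norm_num) (by decide) τ

/-- `Δ(−τ̄) = conj Δ(τ)` (`Δ = (E₄³ − E₆²)/1728`). [folklore] -/
theorem discriminant_negConjPt (τ : ℍ) :
    ModularForm.discriminant (negConjPt τ) = (starRingEnd ℂ) (ModularForm.discriminant τ) := by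
  rw [ModularForm.discriminant_eq_E₄_cube_sub_E₆_sq, ModularForm.discriminant_eq_E₄_cube_sub_E₆_sq]
  rw [E₄_negConjPt, E₆_negConjPt]
  simp [map_ofNat]

/-- `−τ̄` is an involution. [folklore] -/
theorem negConjPt_negConjPt (τ : ℍ) : negConjPt (negConjPt τ) = τ := by
  apply UpperHalfPlane.ext
  simp [coe_negConjPt]

/-- **`g^ε · (−τ̄) = −conj(g · τ)`** for every `τ ∈ ℍ` (the tree's `reflect_smul_axisPt` off the axis).
[cite: CremonaAlgorithms1997, §2.1 (z ↦ z* = -z̄, γ̃ = JγJ)] -/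
theorem reflect_smul_negConjPt (g : SL(2, ℤ)) (τ : ℍ) :
    reflect g • negConjPt τ = negConjPt (g • τ) := by
  apply UpperHalfPlane.ext
  rw [coe_negConjPt, UpperHalfPlane.coe_specialLinearGroup_apply,
    UpperHalfPlane.coe_specialLinearGroup_apply, coe_negConjPt]
  have hden : ((algebraMap ℤ ℝ (g 1 0) : ℝ) : ℂ) * (τ : ℂ) + ((algebraMap ℤ ℝ (g 1 1) : ℝ) : ℂ) ≠ 0 :=
    UpperHalfPlane.denom_ne_zero (g : GL (Fin 2) ℝ) τ
  have hden' : (starRingEnd ℂ) (((algebraMap ℤ ℝ (g 1 0) : ℝ) : ℂ) * (τ : ℂ) +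
      ((algebraMap ℤ ℝ (g 1 1) : ℝ) : ℂ)) ≠ 0 :=
    (map_ne_zero_iff _ (RingHom.injective _)).mpr hden
  have hden2 : ((algebraMap ℤ ℝ (reflect g 1 0) : ℝ) : ℂ) * (-(starRingEnd ℂ) (τ : ℂ)) +
      ((algebraMap ℤ ℝ (reflect g 1 1) : ℝ) : ℂ) ≠ 0 := by
    have e : ((algebraMap ℤ ℝ (reflect g 1 0) : ℝ) : ℂ) * (-(starRingEnd ℂ) (τ : ℂ)) +
        ((algebraMap ℤ ℝ (reflect g 1 1) : ℝ) : ℂ) =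
        (starRingEnd ℂ) (((algebraMap ℤ ℝ (g 1 0) : ℝ) : ℂ) * (τ : ℂ) + ((algebraMap ℤ ℝ (g 1 1) : ℝ) : ℂ)) := by
      simp only [reflect_apply_10, reflect_apply_11, eq_intCast, Int.cast_neg, Complex.ofReal_neg,
        Complex.ofReal_intCast, map_add, map_mul, map_intCast]
      ring
    rw [e]; exact hden'
  simp only [reflect_apply_00, reflect_apply_01, reflect_apply_10, reflect_apply_11, map_neg,
    map_div₀, map_add, map_mul, eq_intCast, Complex.ofReal_neg,
    Complex.ofReal_intCast, map_intCast] at hden hden' hden2 ⊢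
  field_simp
  ring

/-- The automorphy factor at `−τ̄`: `denom(h, −τ̄) = conj denom(h^ε, τ)`. [folklore] -/
theorem denom_negConjPt (h : SL(2, ℤ)) (τ : ℍ) :
    UpperHalfPlane.denom (h : GL (Fin 2) ℝ) (negConjPt τ) =
      (starRingEnd ℂ) (UpperHalfPlane.denom (reflect h : GL (Fin 2) ℝ) τ) := by
  rw [ModularGroup.denom_apply, ModularGroup.denom_apply, coe_negConjPt]
  simp only [reflect_apply_10, reflect_apply_11, Int.cast_neg, map_add, map_mul, map_intCast, map_neg]
  ring

/-- **`(f ∣ h)(−τ̄) = conj ((f ∣ h^ε)(τ))`** for a cusp form `f` with real Fourier coefficients and every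
`τ ∈ ℍ` (the tree's `slash_reflect_axisPt` off the axis). [cite: CremonaAlgorithms1997, §2.8] -/
theorem slash_negConjPt [NeZero N] (f : CuspForm (Gamma0 N) 2)
    (hf : ∀ n, (starRingEnd ℂ) ((qExpansion 1 ⇑f).coeff n) = (qExpansion 1 ⇑f).coeff n)
    (h : SL(2, ℤ)) (τ : ℍ) :
    (⇑f ∣[(2 : ℤ)] h) (negConjPt τ) = (starRingEnd ℂ) ((⇑f ∣[(2 : ℤ)] reflect h) τ) := by
  rw [ModularForm.SL_slash_apply, ModularForm.SL_slash_apply]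
  have h1 : h • negConjPt τ = negConjPt (reflect h • τ) := by
    have := reflect_smul_negConjPt (reflect h) τ
    rwa [reflect_reflect] at this
  rw [h1, apply_negConjPt f hf, map_mul, denom_negConjPt, map_zpow₀]

/-- **The tile integrand under the reflection**: `(ω/dj)(f ∣ h)(−τ̄) = conj ((ω/dj)(f ∣ h^ε)(τ))` for `f`
with real Fourier coefficients. [cite: CremonaAlgorithms1997, §2.8] -/
theorem djQuot_slash_negConjPt [NeZero N] (f : CuspForm (Gamma0 N) 2)
    (hf : ∀ n, (starRingEnd ℂ) ((qExpansion 1 ⇑f).coeff n) = (qExpansion 1 ⇑f).coeff n)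
    (h : SL(2, ℤ)) (τ : ℍ) :
    djQuot (⇑f ∣[(2 : ℤ)] h) (negConjPt τ) = (starRingEnd ℂ) (djQuot (⇑f ∣[(2 : ℤ)] reflect h) τ) := by
  simp only [djQuot, slash_negConjPt f hf h τ, discriminant_negConjPt, E₄_negConjPt, E₆_negConjPt,
    map_neg, map_mul, map_div₀, map_pow]

/-- `T⁻¹ · (1/2 + it) = −1/2 + it = −conj(1/2 + it)`. [folklore] -/
theorem T_inv_smul_ofComplex_half {t : ℝ} (ht : 0 < t) :
    ModularGroup.T⁻¹ • (ofComplex ((1 / 2 : ℂ) + t * I) : ℍ) = negConjPt (ofComplex ((1 / 2 : ℂ) + t * I)) := by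
  apply UpperHalfPlane.ext
  have him : 0 < ((1 / 2 : ℂ) + t * I).im := by simpa using ht
  have hT := UpperHalfPlane.modular_T_zpow_smul (ofComplex ((1 / 2 : ℂ) + t * I)) (-1)
  rw [zpow_neg_one] at hT
  rw [hT, UpperHalfPlane.coe_vadd, coe_negConjPt, UpperHalfPlane.ofComplex_apply_of_im_pos him]
  change ((-1 : ℤ) : ℝ) + ((1 / 2 : ℂ) + t * I) = -(starRingEnd ℂ) ((1 / 2 : ℂ) + t * I)
  simp only [map_add, map_mul, Complex.conj_ofReal, Complex.conj_I, map_div₀, map_one, map_ofNat]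
  push_cast
  ring

/-- **On the axis `A`** (`u > 1728`): the canonical integrand is fixed, up to conjugation and `h ↦ h^ε`:
`arcIntegrand (f ∣ h) u = conj (arcIntegrand (f ∣ h^ε) u)` (the tree's `arcIntegrand_reflect`). [folklore] -/
theorem arcIntegrand_eq_conj_reflect [NeZero N] (f : CuspForm (Gamma0 N) 2)
    (hf : ∀ n, (starRingEnd ℂ) ((qExpansion 1 ⇑f).coeff n) = (qExpansion 1 ⇑f).coeff n)
    (h : SL(2, ℤ)) {u : ℝ} (hu : 1728 < u) :
    arcIntegrand (⇑f ∣[(2 : ℤ)] h) u = (starRingEnd ℂ) (arcIntegrand (⇑f ∣[(2 : ℤ)] reflect h) u) := by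
  rw [arcIntegrand_reflect f hf h hu, Complex.conj_conj]

end Summit.KontsevichZagierPeriods.HeckeMultiplicityOne.ManinStokes
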